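import Literature.MathematicalPhysics.QuantumFieldTheory.Balaban1983to89.Node00.OpsYRead342
import Literature.MathematicalPhysics.QuantumFieldTheory.Balaban1983to89.B9SectBAllBlocksGeometryY

/-!
# `Balaban1983to89.B9SectBAllBlocksWriteY` — WRITE INTO THE RECORD FROM PRINT'S `𝔅`: block majorants of the `b`-conjugated letters over the ALL-BLOCKS
# geometry `geoBK i` (labels = the blocks themselves, NO section of `β`, EVERY member) give the (3.42) block `EBlock` of node00-def-Y's reading
# `kernelFamilyS` at the SAME configuration — the output dictionary (c3) of the row-13 chain over `𝔅`

T. Bałaban, *Propagators for lattice gauge theories in a background field*, Commun. Math. Phys. **99** (1985) 389–434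
[`Balaban1985BackgroundPropagators`, "B9"], (3.42) p. 397 (*"for x ∈ Δ(y), y ∈ Λ_j, supp λ ⊂ Δ(y′) … y, y′ ∈ 𝔅"*); T. Bałaban, *Propagators and renormalization
transformations for lattice gauge theories. II*, Commun. Math. Phys. **96** (1984) 223–250 [`Balaban1984PropagatorsII`, "[4]"], (2.51)–(2.52) p. 232.

statement-level skeleton of published theorems with citation tags; proofs where landed; nothing here is a claim about the
Yang–Mills mass gap

THE POINT (cell `pub-ymgap`, Track A node N06 [B9], row 13; seat `pub-ymgap-dag-n06-c` g10, PLAN (γ′) piece (c3)).  node00-def-Y's same-configuration dictionary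
`Node00.OpsYRead342.eBlock_kernelFamilyS_of_hasMajorant` writes r06 block majorants into the record through a SECTION `ιB : BlkY → IBondY` of the
carrier-block map (`hι : β (ιB s) = s`) — which exists only at corner-free members (`Node00.MemberYCornered`).  Over the all-blocks geometry `geoBK i`
(`B9SectBAllBlocksGeometryY`: sites = `𝔅`, `len`∕`dist` = the record's at the carrier blocks, `len_beta`∕`dist_beta`) the labelling of a fine site is ITS OWN
BLOCK `blkOf`, total at every member; the record reads its outputs on carrier blocks `β b` — sites of `geoBK` — so the write needs no section:
★★ `eBlock_kernelFamilyS_of_hasMajorant_blocks`: the four block majorants `B·ℓ(s)^{(2,1,1,0)}·e^{−δd(s,s′)}` of `conj b (η²O)`, `conj b (η⁻¹∇_μ) * conj b (η²O)`,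
`conj b (η²O) * conj b (−η⁻¹∇*_μ)`, `conj b (η⁻²Δ) * conj b (η²O)` over `(z, j) ↦ Δ(z) ∈ 𝔅` at `cfg U₁` give `EBlock (kernelFamilyS i B cfg O par) (M₂(Σ_j‖b_j‖)B) δ U₁`
— def-Y's §5 proof verbatim with `ιB := id` and the carrier-level rewriting `len_beta`∕`dist_beta`.  (The converse READ on carrier pairs and the orphan pairs'
input are piece (c2), not here.)

HONEST SCOPE.  Finite-dimensional sup bookkeeping over def-Y's readings and r06's majorants; nothing of [B9] asserted; COUNT-NEUTRAL; N06 NOT discharged; one finite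
lattice programme — nothing continuum, nothing about OS positivity or the mass gap.
-/

noncomputable section

namespace Literature.MathematicalPhysics.QuantumFieldTheory.Balaban1983to89.B9SectBAllBlocksWriteY

open B6Geom246MultiLevelBox (bset blkOf)
open B6Ineq2142KLevelV1 (β)
open B6KLevelCensusIndexV1 (KIdx)
open B6Prop22KLevelCensusEta (epow)
open B6RandomWalk (HasMajorant BlockSupp hasMajorant_mono)
open B9Thm34Ext (toB6)
open B9FromB6 (EBlock)
open B9GeoNormsKLevelV1 (geo9K geo9K_supNorm_nonneg)
open B9GeoLemma21KLevelV1 (geo9K_len_pos)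
open B9Eq352DivFormLetters (coordEquiv conj conj_apply coordEquiv_apply)
open B9Eq352GradLetters (diffLetter diffLetter_inl diffLetter_inr)
open B9Ineq347AllEntries (pref4_nonneg)
open B9Ineq349SiteComposite (supBlkS_le supBlkS'_le etaS_pos)
open B9CoReadingCoords (norm_le_basisBound_mul)
open Node00 (SiteY BlkY IBondY CfgY BallY liftY liftY_apply etaS supBlkS supBlkS' kernelFamilyS eLatS SiteOpY SiteParY cdS cdsS lapS UboxY shiftY
  iSup_ball_le)
open Node00.OpsYRead342 (abs_le_supNorm_inl gradF_mul_apply mul_neg_gradB_apply lap_mul_apply)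
open B9SectBAllBlocksGeometryY (geoBK len_beta dist_beta geoBK_dist_eq)

variable {d ℓ : ℕ} {hd : 1 ≤ d + 1} {hL : Odd (ℓ + 1) ∧ 1 < ℓ + 1} {b₀ b₁ : ℝ}
variable {𝔸 : Type} [NormedRing 𝔸] [NormedAlgebra ℂ 𝔸] [CompleteSpace 𝔸]
variable {ι : Type} [Fintype ι]
variable (i : KIdx d ℓ hd hL b₀ b₁) (b : Module.Basis ι ℝ 𝔸)

section Write

variable {B : B9.Backgrounds} (cfg : B.Cfg → CfgY 𝔸 i) (O : SiteOpY 𝔸 i) (par : SiteParY 𝔸 i) {U₁ : B.Cfg}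
variable [Fintype (geoBK i).Site] {Rr : ℝ} {Hp : Prop}

omit [CompleteSpace 𝔸] in
/-- ★ **THE (2.51) WRITING THROUGH COORDINATES, BLOCKS LABELLED BY THEMSELVES**: a block majorant `K` of `conj b T` w.r.t. `(z, j) ↦ Δ(z) ∈ 𝔅` (the all-blocks
geometry) bounds `‖(T(f ⊗ E))(z)‖` for `‖E‖ ≤ 1`, `supp f ⊂ Δ(βy′)` by `(Σ_j‖b_j‖)·K(Δ(z), βy′)·M₂|f|`. [cite: Balaban1984PropagatorsII, (2.51) p.232 («|(Tλ)(x)| ≤ K(y,y′)|λ|»); Balaban1985BackgroundPropagators, (3.42) p.397] -/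
theorem norm_apply_liftY_le_of_hasMajorant_blocks (T : Module.End ℝ (SiteY i → 𝔸))
    {M₂ : ℝ} (hM₂ : 0 ≤ M₂) (hrepr : ∀ (v : 𝔸) (j : ι), |b.repr v j| ≤ M₂ * ‖v‖) {Kmaj : BlkY i → BlkY i → ℝ}
    (h : HasMajorant (g := toB6 (geoBK i) Rr Hp) (fun p : SiteY i × ι => blkOf i.D.toDomains p.1) (conj b T) Kmaj)
    (f : SiteY i → ℝ) (y' : IBondY i) (hs : (geo9K i).suppIn (Sum.inl f) y') {E : 𝔸} (hE : ‖E‖ ≤ 1) (z : SiteY i) :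
    ‖T (liftY f E) z‖ ≤ (∑ j, ‖b j‖) * (Kmaj (blkOf i.D.toDomains z) (β i.hN i.D i.hk y') * (M₂ * (geo9K i).supNorm (Sum.inl f))) := by
  have hN0 : 0 ≤ (geo9K i).supNorm (Sum.inl f) := geo9K_supNorm_nonneg i _
  have hBS : BlockSupp (g := toB6 (geoBK i) Rr Hp) (fun p : SiteY i × ι => blkOf i.D.toDomains p.1) (coordEquiv b (liftY f E))
      (β i.hN i.D i.hk y') (M₂ * (geo9K i).supNorm (Sum.inl f)) := by
    refine ⟨mul_nonneg hM₂ hN0, fun p _ => ?_, fun p hp => ?_⟩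
    · rw [coordEquiv_apply, liftY_apply, Complex.coe_smul, map_smul, Finsupp.smul_apply, smul_eq_mul, abs_mul]
      calc |f p.1| * |b.repr E p.2| ≤ (geo9K i).supNorm (Sum.inl f) * (M₂ * ‖E‖) :=
            mul_le_mul (abs_le_supNorm_inl i f p.1) (hrepr E p.2) (abs_nonneg _) hN0
        _ ≤ (geo9K i).supNorm (Sum.inl f) * M₂ := mul_le_mul_of_nonneg_left (mul_le_of_le_one_right hM₂ hE) hN0
        _ = M₂ * (geo9K i).supNorm (Sum.inl f) := mul_comm _ _
    · have hf : f p.1 = 0 := by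
        by_contra hf
        exact hp (hs p.1 hf)
      rw [coordEquiv_apply, liftY_apply, hf, Complex.ofReal_zero, zero_smul, map_zero, Finsupp.zero_apply]
  have hco : ∀ j : ι, |b.repr (T (liftY f E) z) j| ≤
      Kmaj (blkOf i.D.toDomains z) (β i.hN i.D i.hk y') * (M₂ * (geo9K i).supNorm (Sum.inl f)) := by
    intro j
    have h1 := h _ _ _ hBS (z, j)
    simpa only [conj_apply, LinearEquiv.symm_apply_apply] using h1
  exact norm_le_basisBound_mul b _ hco

/-- ★★ **WRITE AT ONE CONFIGURATION FROM PRINT'S `𝔅`** (every member, no section of `β`): block majorants `B·ℓ(s)^{(2,1,1,0)}·e^{−δd(s,s′)}` over the all-blocks geometry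
`geoBK i` of the four conjugated letters at `cfg U₁` — `conj b (η²O)`, `conj b (η⁻¹∇_μ-letter) * conj b (η²O)` (every `μ`), `conj b (η²O) * conj b (−η⁻¹∇*_μ-letter)`
(every `μ`), `conj b (η⁻²Δ) * conj b (η²O)` — give the (3.42) block of the record's reading `kernelFamilyS i B cfg O par` at `U₁` with constant `M₂(Σ_j‖b_j‖)·B` and
the SAME rate `δ` (the record reads output block `β b` and input block `β c`, both sites of `geoBK`; `len_beta`, `dist_beta`).
[cite: Balaban1985BackgroundPropagators, (3.42) p.397 («y, y′ ∈ 𝔅»); Balaban1984PropagatorsII, (2.51)–(2.52) p.232] -/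
theorem eBlock_kernelFamilyS_of_hasMajorant_blocks
    {M₂ : ℝ} (hM₂ : 0 ≤ M₂) (hrepr : ∀ (v : 𝔸) (j : ι), |b.repr v j| ≤ M₂ * ‖v‖) {η : ℝ} (hη : η = etaS i)
    {Uc : Fin (d + 1) → SiteY i → 𝔸ˣ} (hUc : Uc = UboxY i (cfg U₁))
    (G L : Module.End ℝ (SiteY i → 𝔸)) (hG : ∀ Λ, G Λ = (η ^ 2) • O (cfg U₁) Λ) (hL : ∀ Λ, L Λ = (η ^ 2)⁻¹ • lapS i (cfg U₁) Λ)
    {Bc δ : ℝ} (hBc : 0 ≤ Bc)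
    (h0 : HasMajorant (g := toB6 (geoBK i) Rr Hp) (fun p : SiteY i × ι => blkOf i.D.toDomains p.1) (conj b G)
      (fun s s' => Bc * (geoBK i).len s ^ 2 * Real.exp (-(δ * (geoBK i).dist s s'))))
    (h1 : ∀ μ : Fin (d + 1), HasMajorant (g := toB6 (geoBK i) Rr Hp) (fun p : SiteY i × ι => blkOf i.D.toDomains p.1)
      (conj b (diffLetter (shiftY i) Uc (((η : ℂ))⁻¹) (Sum.inl μ)) * conj b G)
      (fun s s' => Bc * (geoBK i).len s * Real.exp (-(δ * (geoBK i).dist s s'))))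
    (h2 : ∀ μ : Fin (d + 1), HasMajorant (g := toB6 (geoBK i) Rr Hp) (fun p : SiteY i × ι => blkOf i.D.toDomains p.1)
      (conj b G * conj b (diffLetter (shiftY i) Uc (((η : ℂ))⁻¹) (Sum.inr μ)))
      (fun s s' => Bc * (geoBK i).len s * Real.exp (-(δ * (geoBK i).dist s s'))))
    (h3 : HasMajorant (g := toB6 (geoBK i) Rr Hp) (fun p : SiteY i × ι => blkOf i.D.toDomains p.1) (conj b L * conj b G)
      (fun s s' => Bc * 1 * Real.exp (-(δ * (geoBK i).dist s s')))) :
    EBlock (kernelFamilyS i B cfg O par) (M₂ * (∑ j, ‖b j‖) * Bc) δ U₁ := by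
  subst hη hUc
  have hSb : 0 ≤ ∑ j, ‖b j‖ := Finset.sum_nonneg fun _ _ => norm_nonneg _
  have hC : 0 ≤ M₂ * (∑ j, ‖b j‖) * Bc := mul_nonneg (mul_nonneg hM₂ hSb) hBc
  have hlen0 : ∀ y : IBondY i, 0 ≤ (geo9K i).len y := fun y => (geo9K_len_pos i y).le
  intro n lam y y' hs
  have hRHS : 0 ≤ M₂ * (∑ j, ‖b j‖) * Bc * B9.pref4 ((geo9K i).len y) n * Real.exp (-(δ * (geo9K i).dist y y')) * (geo9K i).supNorm lam :=
    mul_nonneg (mul_nonneg (mul_nonneg hC (pref4_nonneg _ (hlen0 y) n)) (Real.exp_pos _).le) (geo9K_supNorm_nonneg i lam)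
  cases lam with
  | inr J => exact hRHS
  | inl f =>
    have hR : ∀ {P : ℝ}, 0 ≤ P →
        0 ≤ M₂ * (∑ j, ‖b j‖) * Bc * P * Real.exp (-(δ * (geo9K i).dist y y')) * (geo9K i).supNorm (Sum.inl f) := fun hP =>
      mul_nonneg (mul_nonneg (mul_nonneg hC hP) (Real.exp_pos _).le) (geo9K_supNorm_nonneg i _)
    -- the record's scale length and distance ARE the all-blocks ones at the carrier blocks
    have hlen : ∀ z : SiteY i, blkOf i.D.toDomains z = β i.hN i.D i.hk y → (geoBK i).len (blkOf i.D.toDomains z) = (geo9K i).len y :=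
      fun z hz => by rw [hz, ← len_beta]
    have hdist : ∀ z : SiteY i, blkOf i.D.toDomains z = β i.hN i.D i.hk y →
        (geoBK i).dist (blkOf i.D.toDomains z) (β i.hN i.D i.hk y') = (geo9K i).dist y y' :=
      fun z hz => by rw [hz, ← dist_beta]
    fin_cases n
    · -- (3.42)₁: η²·sup_E sup_{z ∈ Δ(y)} ‖(O(f ⊗ E))(z)‖
      show etaS i ^ (epow 0) * (⨆ E : BallY 𝔸, eLatS i O (cfg U₁) (liftY f (E : 𝔸)) (β i.hN i.D i.hk y) 0) ≤
        M₂ * (∑ j, ‖b j‖) * Bc * ((geo9K i).len y ^ 2) * Real.exp (-(δ * (geo9K i).dist y y')) * (geo9K i).supNorm (Sum.inl f)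
      have h0e : epow 0 = 2 := rfl
      have hη : 0 < etaS i ^ 2 := pow_pos (etaS_pos i) 2
      rw [h0e, mul_comm, ← le_div_iff₀ hη]
      refine iSup_ball_le (fun E => ?_) (div_nonneg (hR (sq_nonneg _)) hη.le)
      show supBlkS i (β i.hN i.D i.hk y) (O (cfg U₁) (liftY f (E : 𝔸))) ≤ _
      refine supBlkS_le i _ _ (div_nonneg (hR (sq_nonneg _)) hη.le) fun z hz => ?_
      rw [le_div_iff₀ hη, mul_comm]
      have hw := norm_apply_liftY_le_of_hasMajorant_blocks i b (Rr := Rr) (Hp := Hp) G hM₂ hrepr h0 f y' hs (mem_closedBall_zero_iff.1 E.2) z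
      rw [hG, Pi.smul_apply, norm_smul, Real.norm_eq_abs, abs_of_nonneg (sq_nonneg _), hlen z hz, hdist z hz] at hw
      exact hw.trans (le_of_eq (by ring))
    · -- (3.42)₂: η·sup ‖(∇_{V,μ}O(f ⊗ E))(z)‖
      show etaS i ^ (epow 1) * (⨆ E : BallY 𝔸, eLatS i O (cfg U₁) (liftY f (E : 𝔸)) (β i.hN i.D i.hk y) 1) ≤
        M₂ * (∑ j, ‖b j‖) * Bc * (geo9K i).len y * Real.exp (-(δ * (geo9K i).dist y y')) * (geo9K i).supNorm (Sum.inl f)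
      have h1e : epow 1 = 1 := rfl
      have hη : 0 < etaS i := etaS_pos i
      rw [h1e, pow_one, mul_comm, ← le_div_iff₀ hη]
      refine iSup_ball_le (fun E => ?_) (div_nonneg (hR (hlen0 y)) hη.le)
      show supBlkS' i (β i.hN i.D i.hk y) (fun ν => cdS i (cfg U₁) ν (O (cfg U₁) (liftY f (E : 𝔸)))) ≤ _
      refine supBlkS'_le i _ _ (div_nonneg (hR (hlen0 y)) hη.le) fun z ν hz => ?_
      rw [le_div_iff₀ hη, mul_comm]
      have h1' := h1 ν
      rw [diffLetter_inl, ← B9Eq352DivFormLetters.conj_mul] at h1'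
      have hw := norm_apply_liftY_le_of_hasMajorant_blocks i b (Rr := Rr) (Hp := Hp) _ hM₂ hrepr h1' f y' hs (mem_closedBall_zero_iff.1 E.2) z
      rw [gradF_mul_apply i O (cfg U₁) G hG, norm_smul, Complex.norm_real, Real.norm_eq_abs, abs_of_nonneg hη.le, hlen z hz, hdist z hz] at hw
      exact hw.trans (le_of_eq (by ring))
    · -- (3.42)₃: η·sup ‖(O∇*_{V,μ}(f ⊗ E))(z)‖
      show etaS i ^ (epow 2) * (⨆ E : BallY 𝔸, eLatS i O (cfg U₁) (liftY f (E : 𝔸)) (β i.hN i.D i.hk y) 2) ≤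
        M₂ * (∑ j, ‖b j‖) * Bc * (geo9K i).len y * Real.exp (-(δ * (geo9K i).dist y y')) * (geo9K i).supNorm (Sum.inl f)
      have h2e : epow 2 = 1 := rfl
      have hη : 0 < etaS i := etaS_pos i
      rw [h2e, pow_one, mul_comm, ← le_div_iff₀ hη]
      refine iSup_ball_le (fun E => ?_) (div_nonneg (hR (hlen0 y)) hη.le)
      show supBlkS' i (β i.hN i.D i.hk y) (fun ν => O (cfg U₁) (cdsS i (cfg U₁) ν (liftY f (E : 𝔸)))) ≤ _
      refine supBlkS'_le i _ _ (div_nonneg (hR (hlen0 y)) hη.le) fun z ν hz => ?_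
      rw [le_div_iff₀ hη, mul_comm]
      have h2' := h2 ν
      rw [diffLetter_inr, ← B9Eq352DivFormLetters.conj_mul] at h2'
      have hw := norm_apply_liftY_le_of_hasMajorant_blocks i b (Rr := Rr) (Hp := Hp) _ hM₂ hrepr h2' f y' hs (mem_closedBall_zero_iff.1 E.2) z
      rw [mul_neg_gradB_apply i O (cfg U₁) G hG, norm_neg, norm_smul, Complex.norm_real, Real.norm_eq_abs, abs_of_nonneg hη.le, hlen z hz,
        hdist z hz] at hw
      exact hw.trans (le_of_eq (by ring))
    · -- (3.42)₄: sup ‖(Δ_V O(f ⊗ E))(z)‖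
      show etaS i ^ (epow 3) * (⨆ E : BallY 𝔸, eLatS i O (cfg U₁) (liftY f (E : 𝔸)) (β i.hN i.D i.hk y) 3) ≤
        M₂ * (∑ j, ‖b j‖) * Bc * 1 * Real.exp (-(δ * (geo9K i).dist y y')) * (geo9K i).supNorm (Sum.inl f)
      have h3e : epow 3 = 0 := rfl
      rw [h3e, pow_zero, one_mul]
      refine iSup_ball_le (fun E => ?_) (hR zero_le_one)
      show supBlkS i (β i.hN i.D i.hk y) (lapS i (cfg U₁) (O (cfg U₁) (liftY f (E : 𝔸)))) ≤ _
      refine supBlkS_le i _ _ (hR zero_le_one) fun z hz => ?_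
      have h3' := h3
      rw [← B9Eq352DivFormLetters.conj_mul] at h3'
      have hw := norm_apply_liftY_le_of_hasMajorant_blocks i b (Rr := Rr) (Hp := Hp) _ hM₂ hrepr h3' f y' hs (mem_closedBall_zero_iff.1 E.2) z
      rw [lap_mul_apply i O (cfg U₁) G L hG hL, hdist z hz] at hw
      exact hw.trans (le_of_eq (by ring))

end Write

end Literature.MathematicalPhysics.QuantumFieldTheory.Balaban1983to89.B9SectBAllBlocksWriteY

end
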